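import Literature.NumberTheory.PAdicHodge.AinfFontaineLimit
import Literature.NumberTheory.PAdicHodge.AinfFormalGroupPoints
import HarnessLib

/-!
# A series `P = p·f + g(X^p)` acts contractingly on `𝔫 ⊂ 𝔸_inf(F)` (Silverman AEC IV.4.4 ⇒ Fontaine's limit)

Topic `Literature/NumberTheory/PAdicHodge`; sequel of `AinfFontaineLimit` and `AinfFormalGroupPoints`. The
multiplication-by-`p` series of a one-dimensional commutative formal group law over a `ℤ_(p)`-algebra has the shape
`[p](X) = p f(X) + g(X^p)` (Silverman, *AEC* IV.4.4; for an elliptic curve with `p`-integral equation this is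
the tree's `WeierstrassCurve.formalMul_prime_eq_add_subst_X_pow`). This file proves, for an ARBITRARY
constant-term-free power series `P` over a discrete coefficient ring `A → 𝔸_inf(F)` admitting such a
decomposition `P = p·f + g(X^p)` (`f`, `g` constant-term-free), that evaluation `a ↦ P(a)` on the nil ideal
`𝔫 = θ⁻¹(𝔪_{ℂ_F})` is **contracting** for the `(p, ξ)`-adic filtration (`AinfTop.IsContracting`, tree
`AinfFontaineLimit`):

  `a ≡ b (mod (p,ξ)^{n+1}) ⇒ P(a) ≡ P(b) (mod (p,ξ)^{n+2})`      (`isContracting_evalPt₁_of_decomp`),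

because `f(a) ≡ f(b) (mod (p,ξ)^{n+1})` (congruence lemma, tree `AinfTop.evalPt_sub_evalPt_mem`) is multiplied by
`p ∈ (p,ξ)`, and `a^p ≡ b^p (mod (p,ξ)^{n+2})` (`pow_sub_pow_mem_pow_succ`: `(b+d)^p = b^p + p b^{p-1} d`
modulo `d²`) feeds the congruence lemma for `g`. Hence Fontaine's limit `[u] = lim Pⁿ(ûₙ)` (tree `AinfTop.flim`)
exists for every `P`-compatible sequence of points of `𝔪_{ℂ_F}` — the `p`-adic period lift of a formal group
(Fontaine 1977 Ch. V §1; Colmez 1992 §2), once `P = [p]_𝔉`.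

Main results: `pow_sub_pow_mem_pow_succ`, `AinfTop.coe_evalPt₁_decomp` (`P(a) = p·f(a) + g(a^p)` on points),
`AinfTop.isContracting_evalPt₁_of_decomp`. One auxiliary definition (`AinfTop.powPt`, the `p`-th power of a point
of `𝔫`); no named facts, no `sorry`. Nothing about elliptic curves is proved here.

## References
* J. H. Silverman, *The Arithmetic of Elliptic Curves* (2009), IV.4.4 (`[p](T) = p f(T) + g(T^p)`). [SilvermanAEC2009]
* J.-M. Fontaine, *Le corps des périodes p-adiques*, Astérisque 223 (1994), Exp. II §1.2.1. [FontaineAsterisque223III]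
* J.-P. Serre, *Local class field theory* (Cassels–Fröhlich Ch. VI) §3.2. [CasselsFrohlichANT1967]
-/

noncomputable section

open Ideal Filter Field WittVector MvPowerSeries

namespace Literature.NumberTheory.PAdicHodge

open Literature.NumberTheory.GaloisRepresentations
open Literature.NumberTheory.GaloisRepresentations.IsNonarchimedeanLocalField
open Literature.NumberTheory.GaloisRepresentations.LubinTate

/-! ## §1 Ring-theoretic lemmas: the dual-number binomial formula and `a^p ≡ b^p` one level up -/

section Algebra

variable {R : Type*} [CommRing R]

/-- **Dual-number binomial formula**: if `e² = 0` then `(x + e)^{m+1} = x^{m+1} + (m+1)·x^m·e`. [folklore] -/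
private theorem add_pow_of_sq_eq_zero {x e : R} (he : e * e = 0) :
    ∀ m : ℕ, (x + e) ^ (m + 1) = x ^ (m + 1) + (m + 1 : ℕ) * x ^ m * e
  | 0 => by simp
  | m + 1 => by
    rw [pow_succ, add_pow_of_sq_eq_zero he m]
    have : ((m + 1 : ℕ) : R) * x ^ m * e * e = 0 := by rw [mul_assoc, he, mul_zero]
    push_cast at this ⊢
    linear_combination this

/-- `(x + e)^q = x^q` when `e² = 0` and `q·e = 0` (`q ≥ 1`). [folklore] -/
private theorem add_pow_eq_pow_of_sq_eq_zero {x e : R} (he : e * e = 0) {q : ℕ} (hq : 0 < q) (hqe : (q : R) * e = 0) :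
    (x + e) ^ q = x ^ q := by
  obtain ⟨m, rfl⟩ := Nat.exists_eq_add_of_le' hq
  rw [add_pow_of_sq_eq_zero he m, mul_comm ((m + 1 : ℕ) : R), mul_assoc, hqe, mul_zero, add_zero]

/-- **Raising to the `q`-th power improves congruences by one step**: in a commutative ring, if `a − b ∈ I^{n+1}`
and `q ∈ I` (e.g. `q = p`, `I ∋ p`) then `a^q − b^q ∈ I^{n+2}` (`(b + d)^q ≡ b^q + q b^{q-1} d (mod d²)`).
[cite: SilvermanAEC2009, IV.4.4] -/
theorem pow_sub_pow_mem_pow_succ {I : Ideal R} {q : ℕ} (hq : 0 < q) (hqI : (q : R) ∈ I) {n : ℕ} {a b : R}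
    (h : a - b ∈ I ^ (n + 1)) : a ^ q - b ^ q ∈ I ^ (n + 2) := by
  rw [← Ideal.Quotient.eq, map_pow, map_pow]
  set d := a - b with hd
  have ha : a = b + d := by rw [hd]; ring
  have hd2 : d * d ∈ I ^ (n + 2) := by
    have h' : d * d ∈ I ^ (n + 1 + (n + 1)) := by rw [pow_add]; exact Ideal.mul_mem_mul h h
    exact Ideal.pow_le_pow_right (by omega) h'
  have hqd : (q : R) * d ∈ I ^ (n + 2) := by
    rw [show n + 2 = 1 + (n + 1) by ring, pow_add, pow_one]
    exact Ideal.mul_mem_mul hqI h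
  rw [ha, map_add]
  refine add_pow_eq_pow_of_sq_eq_zero ?_ hq ?_
  · rw [← map_mul, Ideal.Quotient.eq_zero_iff_mem]; exact hd2
  · rw [← map_natCast (Ideal.Quotient.mk (I ^ (n + 2))), ← map_mul, Ideal.Quotient.eq_zero_iff_mem]; exact hqd

end Algebra

/-! ## §2 Evaluation of `P = p·f + g(X^p)` on `𝔫` and the contracting property -/

namespace AinfTop

variable {F : Type} [Field F] [ValuativeRel F] [TopologicalSpace F] [IsNonarchimedeanLocalField F]
  {p : ℕ} [Fact p.Prime] [Fact (¬ IsUnit (p : integerC F))]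
  [IsAdicComplete (Ideal.span {(p : integerC F)}) (integerC F)] [CharZero F]
  {hθ : Function.Surjective (fontaineTheta (integerC F) p)}
  {A : Type*} [CommRing A] [UniformSpace A] [DiscreteUniformity A]
  [Algebra A (AinfTop F p)] [ContinuousSMul A (AinfTop F p)]

omit [IsAdicComplete (Ideal.span {(p : integerC F)}) (integerC F)] [CharZero F] in
/-- `p ∈ (p, ξ)`. [cite: FontaineAsterisque223III, Exp. II §1.3.1] -/
theorem natCast_mem_ideal : ((p : ℕ) : AinfTop F p) ∈ (WithIdeal.i : Ideal (AinfTop F p)) := by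
  rw [ideal_eq]; exact Ideal.subset_span (by simp)

omit [IsAdicComplete (Ideal.span {(p : integerC F)}) (integerC F)] [CharZero F] in
/-- `a^p ≡ b^p (mod (p,ξ)^{n+2})` if `a ≡ b (mod (p,ξ)^{n+1})`. [cite: SilvermanAEC2009, IV.4.4] -/
theorem pow_prime_sub_pow_prime_mem {n : ℕ} {a b : AinfTop F p}
    (h : a - b ∈ (WithIdeal.i ^ (n + 1) : Ideal (AinfTop F p))) :
    a ^ p - b ^ p ∈ (WithIdeal.i ^ (n + 2) : Ideal (AinfTop F p)) :=
  pow_sub_pow_mem_pow_succ (Fact.out : p.Prime).pos natCast_mem_ideal h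

/-- The `p`-th power of a point of `𝔫`, as a point of `𝔫`. [folklore] -/
def powPt (a : (nilTheta F p hθ).toIdeal) : (nilTheta F p hθ).toIdeal :=
  ⟨(a : AinfTop F p) ^ p, Ideal.pow_mem_of_mem _ a.2 _ (Fact.out : p.Prime).pos⟩

/-- Unfolding `powPt`. [cite: CasselsFrohlichANT1967, Ch. VI §3.2] -/
@[simp] theorem coe_powPt (a : (nilTheta F p hθ).toIdeal) : (powPt a : AinfTop F p) = (a : AinfTop F p) ^ p := rfl

omit [IsAdicComplete (Ideal.span {(p : integerC F)}) (integerC F)] [CharZero F] [Algebra A (AinfTop F p)]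
  [ContinuousSMul A (AinfTop F p)] [UniformSpace A] [DiscreteUniformity A] [Fact (¬ IsUnit (p : integerC F))] in
/-- `X^p` has no constant term. [cite: SilvermanAEC2009, IV.4.4] -/
theorem constantCoeff_X_pow : PowerSeries.constantCoeff (PowerSeries.X ^ p : PowerSeries A) = 0 := by
  rw [map_pow, PowerSeries.constantCoeff_X, zero_pow (Fact.out : p.Prime).ne_zero]

/-- Evaluating `X^p` at a point `a` of `𝔫` gives `a^p`. [cite: CasselsFrohlichANT1967, Ch. VI §3.2] -/
theorem evalPt_X_pow (a : (nilTheta F p hθ).toIdeal) :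
    evalPt (nilTheta F p hθ) (PowerSeries.X ^ p : PowerSeries A) constantCoeff_X_pow (fun _ : Unit => a) = powPt a := by
  apply Subtype.ext
  rw [coe_evalPt, map_pow, coe_powPt]
  congr 1
  exact aeval_X' ((nilTheta F p hθ).hasEval fun _ : Unit => a) ()

/-- **`P(a) = p·f(a) + g(a^p)` on points**, for `P = p·f + g(X^p)`. [cite: SilvermanAEC2009, IV.4.4] -/
theorem coe_evalPt₁_decomp {P f g : PowerSeries A} (hP0 : PowerSeries.constantCoeff P = 0)
    (hf0 : PowerSeries.constantCoeff f = 0) (hg0 : PowerSeries.constantCoeff g = 0)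
    (hP : P = (p : PowerSeries A) * f + PowerSeries.subst (PowerSeries.X ^ p : PowerSeries A) g)
    (a : (nilTheta F p hθ).toIdeal) :
    (evalPt₁ (nilTheta F p hθ) P hP0 a : AinfTop F p) =
      (p : AinfTop F p) * evalPt₁ (nilTheta F p hθ) f hf0 a + evalPt₁ (nilTheta F p hθ) g hg0 (powPt a) := by
  have hsub0 : MvPowerSeries.constantCoeff (PowerSeries.subst (PowerSeries.X ^ p : PowerSeries A) g) = 0 :=
    constantCoeff_subst_zero (σ := Unit) (a := fun _ => (PowerSeries.X ^ p : PowerSeries A))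
      (fun _ => constantCoeff_X_pow) hg0
  have h1 : (evalPt₁ (nilTheta F p hθ) P hP0 a : AinfTop F p) =
      (p : AinfTop F p) * evalPt₁ (nilTheta F p hθ) f hf0 a +
        (evalPt (nilTheta F p hθ) (PowerSeries.subst (PowerSeries.X ^ p : PowerSeries A) g) hsub0 (fun _ : Unit => a) :
          AinfTop F p) := by
    rw [coe_evalPt₁, coe_evalPt₁, coe_evalPt, hP, map_add, map_mul, map_natCast]
    rfl
  rw [h1, evalPt₁_subst (nilTheta F p hθ) (PowerSeries.X ^ p : PowerSeries A) constantCoeff_X_pow g hg0 hsub0,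
    evalPt_X_pow]

/-- **Silverman's decomposition makes `P` contracting**: if `P = p·f + g(X^p)` with `f`, `g` constant-term-free,
then `a ≡ b (mod (p,ξ)^{n+1}) ⇒ P(a) ≡ P(b) (mod (p,ξ)^{n+2})` on `𝔫` — the hypothesis `IsContracting` of
Fontaine's limit (tree `AinfTop.flim`). [cite: SilvermanAEC2009, IV.4.4] [cite: FontaineAsterisque223III, Exp. II §1.2.1] -/
theorem isContracting_evalPt₁_of_decomp {P f g : PowerSeries A} (hP0 : PowerSeries.constantCoeff P = 0)
    (hf0 : PowerSeries.constantCoeff f = 0) (hg0 : PowerSeries.constantCoeff g = 0)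
    (hP : P = (p : PowerSeries A) * f + PowerSeries.subst (PowerSeries.X ^ p : PowerSeries A) g) :
    IsContracting hθ (evalPt₁ (nilTheta F p hθ) P hP0) := by
  intro n a b hab
  rw [coe_evalPt₁_decomp hP0 hf0 hg0 hP, coe_evalPt₁_decomp hP0 hf0 hg0 hP]
  have hf : (evalPt₁ (nilTheta F p hθ) f hf0 a : AinfTop F p) - evalPt₁ (nilTheta F p hθ) f hf0 b ∈
      (WithIdeal.i ^ (n + 1) : Ideal (AinfTop F p)) :=
    evalPt_sub_evalPt_mem (isClosed_of_pow_le le_rfl) _ _ (fun _ : Unit => a) (fun _ : Unit => b) fun _ => hab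
  have hg : (evalPt₁ (nilTheta F p hθ) g hg0 (powPt a) : AinfTop F p) - evalPt₁ (nilTheta F p hθ) g hg0 (powPt b) ∈
      (WithIdeal.i ^ (n + 2) : Ideal (AinfTop F p)) :=
    evalPt_sub_evalPt_mem (isClosed_of_pow_le le_rfl) _ _ (fun _ : Unit => powPt a) (fun _ : Unit => powPt b)
      fun _ => by rw [coe_powPt, coe_powPt]; exact pow_prime_sub_pow_prime_mem hab
  have hpf : (p : AinfTop F p) * ((evalPt₁ (nilTheta F p hθ) f hf0 a : AinfTop F p) - evalPt₁ (nilTheta F p hθ) f hf0 b) ∈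
      (WithIdeal.i ^ (n + 2) : Ideal (AinfTop F p)) := by
    rw [show n + 2 = 1 + (n + 1) by ring, pow_add, pow_one]
    exact Ideal.mul_mem_mul natCast_mem_ideal hf
  have : (p : AinfTop F p) * (evalPt₁ (nilTheta F p hθ) f hf0 a : AinfTop F p) + evalPt₁ (nilTheta F p hθ) g hg0 (powPt a) -
      ((p : AinfTop F p) * evalPt₁ (nilTheta F p hθ) f hf0 b + evalPt₁ (nilTheta F p hθ) g hg0 (powPt b)) =
      (p : AinfTop F p) * ((evalPt₁ (nilTheta F p hθ) f hf0 a : AinfTop F p) - evalPt₁ (nilTheta F p hθ) f hf0 b) +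
        ((evalPt₁ (nilTheta F p hθ) g hg0 (powPt a) : AinfTop F p) - evalPt₁ (nilTheta F p hθ) g hg0 (powPt b)) := by ring
  rw [this]
  exact Submodule.add_mem _ hpf hg

end AinfTop

end Literature.NumberTheory.PAdicHodge

end
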